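import Literature.AlgebraicGeometry.Morphisms.CechUnitCocycleCoefficients
import Literature.AlgebraicGeometry.Modules.IndexedFrames
import Literature.AlgebraicGeometry.Motives.ThickeningSpecOver
import HarnessLib

/-!
# Model data: reading indexed frames through flat-model isomorphisms `Γ(U a) ⊗_A R ≅ Γ(Y, W a)`

`ModelData f U R Y W` — for a scheme `Y` «= X × Spec R» covered by `W a` «= pr⁻¹(U a)»: `A`-algebra isomorphisms of the
flat models with the sections on single/double/triple overlaps, compatible with restrictions ([StacksProject] Tag 02KG,
affine base change of sections); the MODEL COCYCLE `Φ.cocycle F ∈ UCocycle f U R` of an indexed frame system `F` of a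
module on `Y`; ISO ⟹ REL (`rel_cocycle_of_iso`) and REL ⟹ ISO (`nonempty_iso_of_rel`, [Hartshorne1977] III Ex. 4.5);
morphisms of model data along `ψ : R → R'`, `g : Y' → Y` and `ModelData.Hom.cocycle_pullback` (pulled-back frames have
model cocycle `(model cocycle).map ψ`).  Second part: the INSTANCE `absModelData` for `Y = P ×_K Spec R` over a field
(B-p06 (g8)'s absolute flat model `absModelEquiv` of `Motives/AbsoluteFlatModel`, [StacksProject] Tag 02KG / 02KE), its
morphisms `absModelData_hom` along `absTransition`, and `whiskerLeft_left_eq_absTransition`.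
HC_CM is proved only modulo the 7 printed citations until rung 0 closes.

## References
* The Stacks Project, Tag 02KG (Cohomology of Schemes, Lemma 30.5.1), Tag 02KE (Section 30.5: the base change map).
* [Hartshorne1977] R. Hartshorne, *Algebraic Geometry*, III Ex. 4.5.
* [MumfordAV1970] D. Mumford, *Abelian Varieties*, §13 (proof of the Thm. pp. 125–130).
-/

noncomputable section

universe u v

open TensorProduct CategoryTheory AlgebraicGeometry

namespace Literature.AlgebraicGeometry.Morphisms.CechUnitCocycle

open Literature.AlgebraicGeometry.Modules Opposite TopologicalSpace

open Literature.AlgebraicGeometry.Modules Opposite TopologicalSpace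

variable {A : Type u} [CommRing A] {X : Scheme.{u}} {f : X ⟶ Spec (.of A)} {ι : Type v} {U : ι → X.Opens}
variable {R : Type u} [CommRing R] [Algebra A R]
variable {Y : Scheme.{u}} {W : ι → Y.Opens}

variable (f U R Y W) in
/-- **MODEL DATA** for a scheme `Y` «= X × Spec R» covered by `W a` «= pr⁻¹(U a)»: `A`-algebra isomorphisms
`Γ(U a) ⊗_A R ≅ Γ(Y, W a)`, `Γ(U a ∩ U b) ⊗_A R ≅ Γ(Y, W a ∩ W b)`, `Γ(U_{abc}) ⊗_A R ≅ Γ(Y, W_{abc})` compatible with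
the restrictions single → double → triple (affine base change of sections, Stacks 02KG; instances for
`Y = A₀ × Spec R` are N3c-α, B-p06 (g8)).  Plumbing structure, no axioms. [cite: StacksProject, Tag 02KG] -/
structure ModelData where
  /-- `Γ(U a) ⊗ R ≅ Γ(Y, W a)` -/
  Φ₁ : ∀ a, Sections f (U a) ⊗[A] R ≃+* Γ(Y, W a)
  /-- `Γ(U a ∩ U b) ⊗ R ≅ Γ(Y, W a ∩ W b)` -/
  Φ₂ : ∀ a b, Sections f (U a ⊓ U b) ⊗[A] R ≃+* Γ(Y, W a ⊓ W b)
  /-- `Γ(U_{abc}) ⊗ R ≅ Γ(Y, W_{abc})` -/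
  Φ₃ : ∀ a b c, Sections f (U a ⊓ U b ⊓ U c) ⊗[A] R ≃+* Γ(Y, W a ⊓ W b ⊓ W c)
  /-- compatibility with `W a ∩ W b ≤ W a` -/
  Φ₂_left : ∀ a b x, Φ₂ a b (resR f R (inf_le_left : U a ⊓ U b ≤ U a) x) =
    Y.presheaf.map (homOfLE (inf_le_left : W a ⊓ W b ≤ W a)).op (Φ₁ a x)
  /-- compatibility with `W a ∩ W b ≤ W b` -/
  Φ₂_right : ∀ a b x, Φ₂ a b (resR f R (inf_le_right : U a ⊓ U b ≤ U b) x) =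
    Y.presheaf.map (homOfLE (inf_le_right : W a ⊓ W b ≤ W b)).op (Φ₁ b x)
  /-- compatibility with the face `abc ≤ ab` -/
  Φ₃_12 : ∀ a b c x, Φ₃ a b c (resR f R (le12 a b c) x) =
    Y.presheaf.map (homOfLE (inf_le_left : W a ⊓ W b ⊓ W c ≤ W a ⊓ W b)).op (Φ₂ a b x)
  /-- compatibility with the face `abc ≤ bc` -/
  Φ₃_23 : ∀ a b c x, Φ₃ a b c (resR f R (le23 a b c) x) =
    Y.presheaf.map (homOfLE (le_inf (inf_le_left.trans inf_le_right) inf_le_right : W a ⊓ W b ⊓ W c ≤ W b ⊓ W c)).op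
      (Φ₂ b c x)
  /-- compatibility with the face `abc ≤ ac` -/
  Φ₃_13 : ∀ a b c x, Φ₃ a b c (resR f R (le13 a b c) x) =
    Y.presheaf.map (homOfLE (le_inf (inf_le_left.trans inf_le_left) inf_le_right : W a ⊓ W b ⊓ W c ≤ W a ⊓ W c)).op
      (Φ₂ a c x)

namespace ModelData

variable (Φ : ModelData f U R Y W) {M M' : Y.Modules}

/-- **The model cocycle of an indexed frame system**: its transition functions read in `Γ(U a ∩ U b) ⊗_A R`.
[cite: Hartshorne1977, II Ex. 5.16] -/
def cocycle (F : IFrames M W) : UCocycle f U R where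
  val a b := (Φ.Φ₂ a b).symm (F.tf a b)
  isUnit a b := (F.isUnit_tf a b).map (Φ.Φ₂ a b).symm
  cocycle a b c := by
    apply (Φ.Φ₃ a b c).injective
    rw [map_mul, Φ.Φ₃_12, Φ.Φ₃_23, Φ.Φ₃_13, RingEquiv.apply_symm_apply, RingEquiv.apply_symm_apply,
      RingEquiv.apply_symm_apply]
    exact F.tf_cocycle a b c

/-- Unfolding of the model cocycle. [cite: StacksProject, Tag 02KG] -/
@[simp] theorem cocycle_val (F : IFrames M W) (a b : ι) : (Φ.cocycle F).val a b = (Φ.Φ₂ a b).symm (F.tf a b) := rfl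

/-- **Transported frames have the same model cocycle.** [cite: StacksProject, Tag 02KG] -/
@[simp] theorem cocycle_mapIso (F : IFrames M W) (ψ : M ≅ M') (a b : ι) :
    (Φ.cocycle (F.mapIso ψ)).val a b = (Φ.cocycle F).val a b := by
  simp

/-- **Two frame systems of the same module have model cocycles related by the change-of-frame units.**
[cite: GortzWedhorn2020, Prop. 11.15] -/
theorem rel_cocycle_chg (F F' : IFrames M W) :
    Rel (Φ.cocycle F) (Φ.cocycle F') (fun a => (Φ.Φ₁ a).symm (F.chg F' a)) := by
  intro a b
  apply (Φ.Φ₂ a b).injective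
  rw [map_mul, map_mul, Φ.Φ₂_left, Φ.Φ₂_right, cocycle_val, cocycle_val, RingEquiv.apply_symm_apply,
    RingEquiv.apply_symm_apply, RingEquiv.apply_symm_apply, RingEquiv.apply_symm_apply]
  exact F.chg_rel F' a b

/-- The change-of-frame cochain read in the model is a unit cochain. [cite: StacksProject, Tag 02KG] -/
theorem isUnit_symm_chg (F F' : IFrames M W) (a : ι) : IsUnit ((Φ.Φ₁ a).symm (F.chg F' a)) :=
  (F.isUnit_chg F' a).map _

/-- **ISO ⟹ REL: frames `F` of `M` and `G` of `M'` with `M ≅ M'` have related model cocycles.** [cite: StacksProject, Tag 02KG] -/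
theorem rel_cocycle_of_iso (F : IFrames M W) (G : IFrames M' W) (ψ : M ≅ M') :
    ∃ h : UCochain0 f U R, Rel (Φ.cocycle F) (Φ.cocycle G) (fun a => (h a : Sections f (U a) ⊗[A] R)) := by
  refine ⟨fun a => (Φ.isUnit_symm_chg (F.mapIso ψ) G a).unit, fun a b => ?_⟩
  have := Φ.rel_cocycle_chg (F.mapIso ψ) G a b
  simp only [IsUnit.unit_spec]
  rw [cocycle_mapIso] at this
  exact this

/-- **REL ⟹ ISO: frames of `M`, `M'` on a covering family with related model cocycles give `M ≅ M'`.**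
[cite: Hartshorne1977, III Ex. 4.5] -/
theorem nonempty_iso_of_rel (hW : iSup W = ⊤) (F : IFrames M W) (G : IFrames M' W) (h : (i : ι) → Sections f (U i) ⊗[A] R)
    (hh : ∀ a, IsUnit (h a)) (hrel : Rel (Φ.cocycle F) (Φ.cocycle G) h) : Nonempty (M ≅ M') := by
  refine F.nonempty_iso_of_rel G hW (fun a => Φ.Φ₁ a (h a)) (fun a => (hh a).map _) fun a b => ?_
  have := congrArg (Φ.Φ₂ a b) (hrel a b)
  rw [map_mul, map_mul, Φ.Φ₂_left, Φ.Φ₂_right, cocycle_val, cocycle_val, RingEquiv.apply_symm_apply,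
    RingEquiv.apply_symm_apply] at this
  exact this.symm

end ModelData

/-! ### Change of level: model data related along `ψ : R → R'` and `g : Y' → Y` -/

variable {R' : Type u} [CommRing R'] [Algebra A R'] {Y' : Scheme.{u}} {W' : ι → Y'.Opens}

/-- **A morphism of model data** along `ψ : R → R'` and `g : Y' ⟶ Y` with `g⁻¹(W a) = W' a`: the model isos
intertwine `id ⊗ ψ` with pull-back of sections along `g` (for `Y = X × Spec R`, `Y' = X × Spec R'`,
`g = 1 × Spec ψ`: naturality of affine base change). Plumbing structure. [cite: StacksProject, Tag 02KG] -/
structure ModelData.Hom (Φ : ModelData f U R Y W) (Φ' : ModelData f U R' Y' W') (ψ : R →ₐ[A] R') (g : Y' ⟶ Y) : Prop where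
  /-- `g⁻¹(W a) = W' a` -/
  preimage : ∀ a, g ⁻¹ᵁ W a = W' a
  /-- naturality on double overlaps -/
  Φ₂_coef : ∀ a b x, Φ'.Φ₂ a b (coef f ψ _ x) =
    g.appLE (W a ⊓ W b) (W' a ⊓ W' b) (by rw [← preimage, ← preimage, Scheme.Hom.preimage_inf]) (Φ.Φ₂ a b x)

/-- **Pulled-back frames have model cocycle `(model cocycle).map ψ`.** [cite: StacksProject, Tag 02KG] -/
theorem ModelData.Hom.cocycle_pullback {Φ : ModelData f U R Y W} {Φ' : ModelData f U R' Y' W'} {ψ : R →ₐ[A] R'}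
    {g : Y' ⟶ Y} (hg : Φ.Hom Φ' ψ g) {M : Y.Modules} (F : IFrames M W) (G : IFrames ((Scheme.Modules.pullback g).obj M) W')
    (hG : ∀ a b, G.tf a b = g.appLE (W a ⊓ W b) (W' a ⊓ W' b)
      (by rw [← hg.preimage, ← hg.preimage, Scheme.Hom.preimage_inf]) (F.tf a b)) (a b : ι) :
    (Φ'.cocycle G).val a b = ((Φ.cocycle F).map ψ).val a b := by
  rw [ModelData.cocycle_val, UCocycle.map_val, ModelData.cocycle_val]
  apply (Φ'.Φ₂ a b).injective
  rw [RingEquiv.apply_symm_apply, hg.Φ₂_coef, RingEquiv.apply_symm_apply]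
  exact hG a b

/-- Composition of `Rel`: `Rel u u' h → Rel u' u'' h' → Rel u u'' (h' * h)`. [cite: GortzWedhorn2020, Prop. 11.15 and Remark 11.16] -/
theorem Rel.trans' {u u' u'' : UCocycle f U R} {h h' : (i : ι) → Sections f (U i) ⊗[A] R}
    (hr : Rel u u' h) (hr' : Rel u' u'' h') : Rel u u'' (fun i => h' i * h i) := by
  intro i j
  rw [map_mul, map_mul, mul_assoc, hr i j, ← mul_assoc, hr' i j, mul_assoc]

end Literature.AlgebraicGeometry.Morphisms.CechUnitCocycle

/-! ## The model data of the absolute flat model `Γ(V) ⊗_K R ≅ Γ(pr_P⁻¹V)` (B-p06 (g8) α3, packaged for the cocycle calculus) -/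

namespace Literature.AlgebraicGeometry.Motives

open CategoryTheory CategoryTheory.Limits AlgebraicGeometry TopologicalSpace Opposite
open TensorProduct IsLocalRing MonoidalCategory
open Literature.AlgebraicGeometry.Morphisms

section Packaged

open Literature.AlgebraicGeometry.Morphisms.CechUnitCocycle

variable {K : Type u} [Field K] (P : SchemeOver K) {R : Type u} [CommRing R] [Algebra K R]
  (s : Spec (CommRingCat.of R) ⟶ Spec (CommRingCat.of K))
  (hs : s = Spec.map (CommRingCat.ofHom (algebraMap K R)))

omit [Algebra K R] in
/-- Intersections of affine opens of a separated `K`-scheme are affine (Mathlib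
`isAffineHom_diagonal_iff`). [cite: StacksProject, Tag 02KG] -/
theorem isAffineOpen_inf_of_isSeparated [IsSeparated P.hom] {V W : P.left.Opens} (hV : IsAffineOpen V)
    (hW : IsAffineOpen W) : IsAffineOpen (V ⊓ W) :=
  isAffineHom_diagonal_iff.mp (inferInstance : IsAffineHom (pullback.diagonal P.hom)) ⊤
    (isAffineOpen_top _) V le_top W le_top hV hW

/-- **(γ2) THE ABSOLUTE MODEL DATA of `P ×_K Spec R` on the preimages of a finite affine cover** `V` of a
separated `K`-scheme `P`: the three families of isomorphisms `Γ(V_•) ⊗_K R ≅ Γ(pr_P⁻¹V_•)` of §1 with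
their restriction compatibilities, as an instance of the unit-cocycle calculus' `ModelData`.
[cite: StacksProject, Tag 02KH (degree 0)] -/
def absModelData [IsSeparated P.hom] {ι : Type v} (V : ι → P.left.Opens) (hV : ∀ a, IsAffineOpen (V a)) :
    ModelData P.hom V R (pullback P.hom s) (fun a => pullback.fst P.hom s ⁻¹ᵁ V a) where
  Φ₁ a := (absModelEquiv P s hs (hV a)).toRingEquiv
  Φ₂ a b := (absModelEquiv P s hs (isAffineOpen_inf_of_isSeparated P (hV a) (hV b))).toRingEquiv
  Φ₃ a b c := (absModelEquiv P s hs (isAffineOpen_inf_of_isSeparated P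
    (isAffineOpen_inf_of_isSeparated P (hV a) (hV b)) (hV c))).toRingEquiv
  Φ₂_left a b x := by
    change absModelHom P s hs (le_refl (pullback.fst P.hom s ⁻¹ᵁ (V a ⊓ V b)))
        (Algebra.TensorProduct.map (Sections.res P.hom (inf_le_left : V a ⊓ V b ≤ V a)) (AlgHom.id K R) x) =
      Sections.res (restrictBase K (pullback.snd P.hom s))
        (inf_le_left : pullback.fst P.hom s ⁻¹ᵁ V a ⊓ pullback.fst P.hom s ⁻¹ᵁ V b ≤ pullback.fst P.hom s ⁻¹ᵁ V a)
        (absModelHom P s hs (le_refl (pullback.fst P.hom s ⁻¹ᵁ V a)) x)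
    exact (absModelHom_map_res P s hs _ _ x).trans (res_absModelHom P s hs _ _ x).symm
  Φ₂_right a b x := by
    change absModelHom P s hs (le_refl (pullback.fst P.hom s ⁻¹ᵁ (V a ⊓ V b)))
        (Algebra.TensorProduct.map (Sections.res P.hom (inf_le_right : V a ⊓ V b ≤ V b)) (AlgHom.id K R) x) =
      Sections.res (restrictBase K (pullback.snd P.hom s))
        (inf_le_right : pullback.fst P.hom s ⁻¹ᵁ V a ⊓ pullback.fst P.hom s ⁻¹ᵁ V b ≤ pullback.fst P.hom s ⁻¹ᵁ V b)
        (absModelHom P s hs (le_refl (pullback.fst P.hom s ⁻¹ᵁ V b)) x)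
    exact (absModelHom_map_res P s hs _ _ x).trans (res_absModelHom P s hs _ _ x).symm
  Φ₃_12 a b c x := by
    change absModelHom P s hs (le_refl (pullback.fst P.hom s ⁻¹ᵁ (V a ⊓ V b ⊓ V c)))
        (Algebra.TensorProduct.map (Sections.res P.hom (le12 (U := V) a b c)) (AlgHom.id K R) x) =
      Sections.res (restrictBase K (pullback.snd P.hom s))
        (inf_le_left : pullback.fst P.hom s ⁻¹ᵁ V a ⊓ pullback.fst P.hom s ⁻¹ᵁ V b ⊓ pullback.fst P.hom s ⁻¹ᵁ V c ≤
          pullback.fst P.hom s ⁻¹ᵁ V a ⊓ pullback.fst P.hom s ⁻¹ᵁ V b)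
        (absModelHom P s hs (le_refl (pullback.fst P.hom s ⁻¹ᵁ (V a ⊓ V b))) x)
    exact (absModelHom_map_res P s hs _ _ x).trans (res_absModelHom P s hs _ _ x).symm
  Φ₃_23 a b c x := by
    change absModelHom P s hs (le_refl (pullback.fst P.hom s ⁻¹ᵁ (V a ⊓ V b ⊓ V c)))
        (Algebra.TensorProduct.map (Sections.res P.hom (le23 (U := V) a b c)) (AlgHom.id K R) x) =
      Sections.res (restrictBase K (pullback.snd P.hom s))
        (le_inf (inf_le_left.trans inf_le_right) inf_le_right :
          pullback.fst P.hom s ⁻¹ᵁ V a ⊓ pullback.fst P.hom s ⁻¹ᵁ V b ⊓ pullback.fst P.hom s ⁻¹ᵁ V c ≤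
            pullback.fst P.hom s ⁻¹ᵁ V b ⊓ pullback.fst P.hom s ⁻¹ᵁ V c)
        (absModelHom P s hs (le_refl (pullback.fst P.hom s ⁻¹ᵁ (V b ⊓ V c))) x)
    exact (absModelHom_map_res P s hs _ _ x).trans (res_absModelHom P s hs _ _ x).symm
  Φ₃_13 a b c x := by
    change absModelHom P s hs (le_refl (pullback.fst P.hom s ⁻¹ᵁ (V a ⊓ V b ⊓ V c)))
        (Algebra.TensorProduct.map (Sections.res P.hom (le13 (U := V) a b c)) (AlgHom.id K R) x) =
      Sections.res (restrictBase K (pullback.snd P.hom s))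
        (le_inf (inf_le_left.trans inf_le_left) inf_le_right :
          pullback.fst P.hom s ⁻¹ᵁ V a ⊓ pullback.fst P.hom s ⁻¹ᵁ V b ⊓ pullback.fst P.hom s ⁻¹ᵁ V c ≤
            pullback.fst P.hom s ⁻¹ᵁ V a ⊓ pullback.fst P.hom s ⁻¹ᵁ V c)
        (absModelHom P s hs (le_refl (pullback.fst P.hom s ⁻¹ᵁ (V a ⊓ V c))) x)
    exact (absModelHom_map_res P s hs _ _ x).trans (res_absModelHom P s hs _ _ x).symm

/-- The model isomorphisms of `absModelData` are the `absModelEquiv`s of §1 (single opens). [cite: StacksProject, Tag 02KG] -/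
@[simp] theorem absModelData_Φ₁ [IsSeparated P.hom] {ι : Type v} (V : ι → P.left.Opens)
    (hV : ∀ a, IsAffineOpen (V a)) (a : ι) (x : Sections P.hom (V a) ⊗[K] R) :
    (absModelData P s hs V hV).Φ₁ a x = absModelHom P s hs (le_refl _) x :=
  rfl

/-- The model isomorphisms of `absModelData` on double overlaps. [cite: StacksProject, Tag 02KG] -/
@[simp] theorem absModelData_Φ₂ [IsSeparated P.hom] {ι : Type v} (V : ι → P.left.Opens)
    (hV : ∀ a, IsAffineOpen (V a)) (a b : ι) (x : Sections P.hom (V a ⊓ V b) ⊗[K] R) :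
    (absModelData P s hs V hV).Φ₂ a b x = absModelHom P s hs (le_refl _) x :=
  rfl

/-- The model isomorphisms of `absModelData` on triple overlaps. [cite: StacksProject, Tag 02KG] -/
@[simp] theorem absModelData_Φ₃ [IsSeparated P.hom] {ι : Type v} (V : ι → P.left.Opens)
    (hV : ∀ a, IsAffineOpen (V a)) (a b c : ι) (x : Sections P.hom (V a ⊓ V b ⊓ V c) ⊗[K] R) :
    (absModelData P s hs V hV).Φ₃ a b c x = absModelHom P s hs (le_refl _) x :=
  rfl

variable {R' : Type u} [CommRing R'] [Algebra K R']
  (s' : Spec (CommRingCat.of R') ⟶ Spec (CommRingCat.of K))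
  (hs' : s' = Spec.map (CommRingCat.ofHom (algebraMap K R'))) (ψ : R →ₐ[K] R')

/-- **(γ2) The absolute model data are related along `ψ : R → R'` and the transition morphism
`P ×_K Spec R' → P ×_K Spec R`** (`ModelData.Hom`: `τ⁻¹(pr_P⁻¹V_a) = pr_P'⁻¹V_a` and the model isos
intertwine `id ⊗ ψ` with `τ^*`). [cite: StacksProject, Tag 02KG] -/
theorem absModelData_hom [IsSeparated P.hom] {ι : Type v} (V : ι → P.left.Opens)
    (hV : ∀ a, IsAffineOpen (V a)) :
    (absModelData P s hs V hV).Hom (absModelData P s' hs' V hV) ψ (absTransition P s hs s' hs' ψ) where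
  preimage a := absTransition_preimage_fst_preimage P s hs s' hs' ψ (V a)
  Φ₂_coef a b x := by
    symm
    exact comap_absModelHom P s hs s' hs' ψ (le_refl _) _ (le_refl _) x

/-- The same for ANY morphism `τ : P ×_K Spec R' → P ×_K Spec R` with the two projections of the
transition morphism (e.g. `(P ◁ u).left` for `u = Over.homMk (Spec ψ) _`, see
`whiskerLeft_left_eq_absTransition`). [cite: StacksProject, Tag 02KG] -/
theorem absModelData_hom_of [IsSeparated P.hom] {ι : Type v} (V : ι → P.left.Opens)
    (hV : ∀ a, IsAffineOpen (V a)) (τ : pullback P.hom s' ⟶ pullback P.hom s)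
    (h₁ : τ ≫ pullback.fst P.hom s = pullback.fst P.hom s')
    (h₂ : τ ≫ pullback.snd P.hom s = pullback.snd P.hom s' ≫ Spec.map (CommRingCat.ofHom ψ.toRingHom)) :
    (absModelData P s hs V hV).Hom (absModelData P s' hs' V hV) ψ τ := by
  rw [absTransition_eq_of hs hs' ψ τ h₁ h₂]
  exact absModelData_hom P s hs s' hs' ψ V hV

/-- **`(P ◁ u).left` is the transition morphism** for any `u : Over.mk s' ⟶ Over.mk s` over `Spec K`
with `u.left = Spec ψ` (e.g. `u = Over.homMk (Spec.map (CommRingCat.ofHom ψ.toRingHom)) _`, or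
`u = thickeningPtTransition T x n` with `ψ = thickπₐ T x n`). [cite: StacksProject, Tag 02KG] -/
theorem whiskerLeft_left_eq_absTransition (u : Over.mk s' ⟶ Over.mk s)
    (hu : u.left = Spec.map (CommRingCat.ofHom ψ.toRingHom)) :
    (P ◁ u).left = absTransition P s hs s' hs' ψ := by
  refine absTransition_eq_of hs hs' ψ _ ?_ ?_
  · change (P ◁ u).left ≫ (CartesianMonoidalCategory.fst P (Over.mk s)).left =
      (CartesianMonoidalCategory.fst P (Over.mk s')).left
    rw [← Over.comp_left, CartesianMonoidalCategory.whiskerLeft_fst]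
  · change (P ◁ u).left ≫ (CartesianMonoidalCategory.snd P (Over.mk s)).left =
      (CartesianMonoidalCategory.snd P (Over.mk s')).left ≫ _
    rw [← Over.comp_left, CartesianMonoidalCategory.whiskerLeft_snd, Over.comp_left, hu]

end Packaged

end Literature.AlgebraicGeometry.Motives

namespace Literature.AlgebraicGeometry.Morphisms.CechUnitCocycle

end Literature.AlgebraicGeometry.Morphisms.CechUnitCocycle

end
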